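import Mathlib
import Summits.QuantumFields.QCD.Theses.PauliWegnerSea
import Literature.MathematicalPhysics.QuantumFieldTheory.QCDPhaseQuenchedMomentUpgrade
import Literature.MathematicalPhysics.QuantumLattice.WilsonDiracAP
import Literature.MathematicalPhysics.QuantumFieldTheory.LatticeGaugeProofs

/-!
# Stub `stub_twoPoint` of line `crossing-split-integrability`
(crux `Summit.QuantumFields.QCD.Theses.PauliWegnerSea.PhaseQuenchedFlavourDecay` =
`Summit.QuantumFields.QCD.Theses.WilsonMobilityGap.PhaseQuenchedFlavourDecay`, item stmt-QuantumFields-9151)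

Upper transported to an arbitrary base site by torus translation invariance.  Size M.  The statement below is the REGISTERED stub signature (tree vocabulary only);
prove it as stated.  Docstring every declaration; no `sorry`; no warnings.
-/

noncomputable section

namespace Summit.QuantumFields.QCD.Cruxes.PhaseQuenchedFlavourDecay.CrossingSplitIntegrability

open scoped BigOperators
open MeasureTheory Filter
open Literature.MathematicalPhysics.QuantumFieldTheory Literature.MathematicalPhysics.QuantumLattice
  Literature.Probability.LatticeModels


/-! ### Torus translation covariance of the propagator and invariance of the weighted integral -/

/-- Translation covariance of the quark propagator entries: the `((f,(x,c)),(g,(y,c')))` entry of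
`D(τ_z U)⁻¹` is the `((f,(x-z,c)),(g,(y-z,c')))` entry of `D(U)⁻¹` (the flavour-diagonal lift of
`wilsonDirac_torusConfigShift`, plus `Matrix.inv_submatrix_equiv`). -/
private theorem inv_diracMatrix_torusConfigShift_apply {Nf L : ℕ} [NeZero L]
    (U : GaugeConfig 4 L SU3) (mq : Fin Nf → ℝ) (z : TorusSite 4 L) (f g : Fin Nf)
    (x y : TorusSite 4 L) (c c' : Fin 3 × Fin 4) :
    (diracMatrix (torusConfigShift z U) mq)⁻¹ (quarkEquiv (f, (x, c))) (quarkEquiv (g, (y, c'))) =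
      (diracMatrix U mq)⁻¹ (quarkEquiv (f, (x - z, c))) (quarkEquiv (g, (y - z, c'))) := by
  set e : QuarkVar Nf L ≃ QuarkVar Nf L :=
    (Equiv.refl (Fin Nf)).prodCongr ((Equiv.subRight z).prodCongr (Equiv.refl (Fin 3 × Fin 4)))
    with he
  have hD : diracMatrix (torusConfigShift z U) mq =
      (diracMatrix U mq).submatrix (quarkEquiv.symm.trans (e.trans quarkEquiv))
        (quarkEquiv.symm.trans (e.trans quarkEquiv)) := by
    ext i j
    simp only [diracMatrix, Matrix.reindex_apply, Matrix.submatrix_apply, Matrix.of_apply,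
      wilsonDirac_torusConfigShift, Equiv.trans_apply, Equiv.symm_apply_apply, he,
      Equiv.prodCongr_apply, Prod.map_apply', Equiv.refl_apply, Equiv.subRight_apply]
  rw [hD, Matrix.inv_submatrix_equiv]
  simp [he, Matrix.submatrix_apply]

/-- Translation invariance of the `|det D|`-weighted Wilson integral:
`∫ |det D(U)| φ(τ_z U) dμ_W = ∫ |det D(U)| φ(U) dμ_W` (the weight and `μ_W` are translation
invariant: `fermionDet_wilsonDirac_torusConfigShift`, `wilsonMeasure_map_torusConfigShift`). -/
private theorem integral_normDet_mul_comp_torusConfigShift {Nf L : ℕ} [NeZero L] (β : ℝ)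
    (mq : Fin Nf → ℝ) (z : TorusSite 4 L) (φ : GaugeConfig 4 L SU3 → ℝ) :
    ∫ U, ‖(diracMatrix U mq).det‖ * φ (torusConfigShift z U)
        ∂(wilsonMeasure (d := 4) (L := L) (fundamentalRep (Fin 3)) β) =
      ∫ U, ‖(diracMatrix U mq).det‖ * φ U
        ∂(wilsonMeasure (d := 4) (L := L) (fundamentalRep (Fin 3)) β) := by
  have hdet : ∀ U : GaugeConfig 4 L SU3,
      ‖(diracMatrix (torusConfigShift z U) mq).det‖ = ‖(diracMatrix U mq).det‖ := fun U => by
    rw [norm_det_diracMatrix, norm_det_diracMatrix]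
    simp_rw [fermionDet_wilsonDirac_torusConfigShift]
  calc ∫ U, ‖(diracMatrix U mq).det‖ * φ (torusConfigShift z U)
        ∂(wilsonMeasure (d := 4) (L := L) (fundamentalRep (Fin 3)) β)
      = ∫ U, ‖(diracMatrix (torusConfigShift z U) mq).det‖ * φ (torusConfigShift z U)
        ∂(wilsonMeasure (d := 4) (L := L) (fundamentalRep (Fin 3)) β) := by simp_rw [hdet]
    _ = ∫ U, ‖(diracMatrix U mq).det‖ * φ U
        ∂((wilsonMeasure (d := 4) (L := L) (fundamentalRep (Fin 3)) β).map (torusConfigShift z)) :=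
          (integral_map_equiv (torusConfigShift z) (fun U => ‖(diracMatrix U mq).det‖ * φ U)).symm
    _ = _ := by rw [wilsonMeasure_map_torusConfigShift]

/-- The weighted integral of the `s`-th power of the colour–spin entry sum of the propagator
between `x` and `y` equals the one between `0` and `y - x` (change of variables `U = τ_x U'`). -/
private theorem integral_normDet_mul_entrySum_rpow_shift {Nf L : ℕ} [NeZero L] (β : ℝ)
    (mq : Fin Nf → ℝ) (f : Fin Nf) (x y : TorusSite 4 L) (s : ℝ) :
    ∫ U, ‖(diracMatrix U mq).det‖ *
        (∑ a : Fin 3, ∑ i : Fin 4, ∑ b : Fin 3, ∑ j : Fin 4,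
          ‖(diracMatrix U mq)⁻¹ (quarkEquiv (f, (x, a, i))) (quarkEquiv (f, (y, b, j)))‖) ^ s
        ∂(wilsonMeasure (d := 4) (L := L) (fundamentalRep (Fin 3)) β) =
      ∫ U, ‖(diracMatrix U mq).det‖ *
        (∑ a : Fin 3, ∑ i : Fin 4, ∑ b : Fin 3, ∑ j : Fin 4,
          ‖(diracMatrix U mq)⁻¹ (quarkEquiv (f, ((0 : TorusSite 4 L), a, i)))
            (quarkEquiv (f, (y - x, b, j)))‖) ^ s
        ∂(wilsonMeasure (d := 4) (L := L) (fundamentalRep (Fin 3)) β) := by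
  have h := integral_normDet_mul_comp_torusConfigShift β mq x
    (fun U => (∑ a : Fin 3, ∑ i : Fin 4, ∑ b : Fin 3, ∑ j : Fin 4,
      ‖(diracMatrix U mq)⁻¹ (quarkEquiv (f, (x, a, i))) (quarkEquiv (f, (y, b, j)))‖) ^ s)
  rw [← h]
  simp only [inv_diracMatrix_torusConfigShift_apply, sub_self]

/-- In the degenerate case `∫ |det D| dμ_W = 0` the phase-quenched measure is the zero measure. -/
private theorem qcdLatticeMeasure_eq_zero_of_integral_le {Nf L : ℕ} [NeZero L] (β : ℝ)
    (mq : Fin Nf → ℝ)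
    (hZ : ¬ 0 < ∫ U, ‖(diracMatrix U mq).det‖
      ∂(wilsonMeasure (d := 4) (L := L) (fundamentalRep (Fin 3)) β)) :
    qcdLatticeMeasure L β mq = 0 := by
  have hZ0 : ∫ U, ‖(diracMatrix U mq).det‖
      ∂(wilsonMeasure (d := 4) (L := L) (fundamentalRep (Fin 3)) β) = 0 :=
    le_antisymm (not_lt.1 hZ) (integral_nonneg fun _ => norm_nonneg _)
  have hW : qcdLatticeWeight L β mq = 0 :=
    Measure.measure_univ_eq_zero.1
      (by rw [qcdLatticeWeight_univ, hZ0, ENNReal.ofReal_zero, mul_zero])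
  rw [qcdLatticeMeasure, hW, smul_zero]

/-- Registered stub `stub_twoPoint` of line `crossing-split-integrability` for crux stmt-QuantumFields-9151:
Upper transported to an arbitrary base site by torus translation invariance. -/
theorem stub_twoPoint :
    ∀ (Nf : ℕ) (reg : QCDRegularisation Nf) (m : Fin Nf → ℝ),
      (∃ s δ C : ℝ, 0 < s ∧ s < 1 ∧ 0 < δ ∧ ∀ᶠ k in atTop, ∀ S : ℕ, reg.L k ≤ S → ∀ (f : Fin Nf) (v : Literature.Probability.LatticeModels.Site 4), v ∈ box 4 S → (∫ U : GaugeConfig 4 (2 * S + 1) (Matrix.specialUnitaryGroup (Fin 3) ℂ), ‖(diracMatrix U fun fl => reg.mcrit k + reg.a k * m fl / reg.Zm k).det‖ * (∑ a : Fin 3, ∑ i : Fin 4, ∑ b : Fin 3, ∑ j : Fin 4, ‖(diracMatrix U fun fl => reg.mcrit k + reg.a k * m fl / reg.Zm k)⁻¹ (quarkEquiv (f, (Torus.proj (2 * S + 1) 0, a, i))) (quarkEquiv (f, (Torus.proj (2 * S + 1) (v), b, j)))‖) ^ s ∂(wilsonMeasure (fundamentalRep (Fin 3)) (reg.β k)))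 / (∫ U : GaugeConfig 4 (2 * S + 1) (Matrix.specialUnitaryGroup (Fin 3) ℂ), ‖(diracMatrix U fun fl => reg.mcrit k + reg.a k * m fl / reg.Zm k).det‖ ∂(wilsonMeasure (fundamentalRep (Fin 3)) (reg.β k))) ≤ C * Real.exp (-(δ * (reg.a k * ‖v‖)))) →
      (∃ s δ C : ℝ, 0 < s ∧ s < 1 ∧ 0 < δ ∧ ∀ᶠ k in atTop, ∀ S : ℕ, reg.L k ≤ S →
        ∀ (f : Fin Nf) (x : TorusSite 4 (2 * S + 1)) (v : Literature.Probability.LatticeModels.Site 4), v ∈ box 4 S →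
          Integrable (fun U : GaugeConfig 4 (2 * S + 1) SU3 =>
              (∑ a : Fin 3, ∑ i : Fin 4, ∑ b : Fin 3, ∑ j : Fin 4,
                ‖(diracMatrix U fun fl => reg.mcrit k + reg.a k * m fl / reg.Zm k)⁻¹ (quarkEquiv (f, (x, a, i)))
                  (quarkEquiv (f, (x + Torus.proj (2 * S + 1) v, b, j)))‖) ^ s)
              (qcdLatticeMeasure (2 * S + 1) (reg.β k) fun fl => reg.mcrit k + reg.a k * m fl / reg.Zm k) ∧
            qcdPhaseQuenchedExpect (reg.β k) (2 * S + 1) (fun fl => reg.mcrit k + reg.a k * m fl / reg.Zm k)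
                (fun U : GaugeConfig 4 (2 * S + 1) SU3 =>
                  (∑ a : Fin 3, ∑ i : Fin 4, ∑ b : Fin 3, ∑ j : Fin 4,
                    ‖(diracMatrix U fun fl => reg.mcrit k + reg.a k * m fl / reg.Zm k)⁻¹ (quarkEquiv (f, (x, a, i)))
                      (quarkEquiv (f, (x + Torus.proj (2 * S + 1) v, b, j)))‖) ^ s) ≤
              C * Real.exp (-(δ * (reg.a k * ‖v‖)))) := by
  intro Nf reg m hUpper
  obtain ⟨s, δ, C, hs0, hs1, hδ, hev⟩ := hUpper
  refine ⟨s, δ, C, hs0, hs1, hδ, hev.mono fun k hk S hS f x v hv => ?_⟩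
  have hU := hk S hS f v hv
  have h0 : Torus.proj (2 * S + 1) (0 : Literature.Probability.LatticeModels.Site 4) = 0 :=
    funext fun i => by simp [Torus.proj_apply]
  rw [h0] at hU
  set mq : Fin Nf → ℝ := fun fl => reg.mcrit k + reg.a k * m fl / reg.Zm k
  refine ⟨?_, ?_⟩
  · -- integrability of the fractional power of the entry sum under the phase-quenched measure
    by_cases hZ : 0 < ∫ U, ‖(diracMatrix U mq).det‖
        ∂(wilsonMeasure (d := 4) (L := 2 * S + 1) (fundamentalRep (Fin 3)) (reg.β k))
    · haveI := isProbabilityMeasure_qcdLatticeMeasure (S := 2 * S + 1) (reg.β k) mq hZ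
      have hint := integrable_propagatorEntrySum_qcdLatticeMeasure (S := 2 * S + 1) (reg.β k) mq hZ
        f x (x + Torus.proj (2 * S + 1) v)
      refine ((integrable_const (1 : ℝ)).add hint).mono'
        (hint.aestronglyMeasurable.aemeasurable.pow_const s).aestronglyMeasurable
        (Eventually.of_forall fun U => ?_)
      have hnn : 0 ≤ ∑ a : Fin 3, ∑ i : Fin 4, ∑ b : Fin 3, ∑ j : Fin 4,
          ‖(diracMatrix U mq)⁻¹ (quarkEquiv (f, (x, a, i)))
            (quarkEquiv (f, (x + Torus.proj (2 * S + 1) v, b, j)))‖ := by positivity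
      rw [Real.norm_eq_abs, abs_of_nonneg (Real.rpow_nonneg hnn _)]
      exact Literature.Probability.Moments.rpow_le_one_add hnn hs0.le hs1.le
    · rw [qcdLatticeMeasure_eq_zero_of_integral_le (reg.β k) mq hZ]
      exact integrable_zero_measure
  · -- the expectation: change variables `U = τ_x U'` and use the hypothesis at base point `0`
    rw [qcdPhaseQuenchedExpect_eq_div, integral_normDet_mul_entrySum_rpow_shift,
      add_sub_cancel_left]
    exact hU

end Summit.QuantumFields.QCD.Cruxes.PhaseQuenchedFlavourDecay.CrossingSplitIntegrability

end
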